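import Literature.Computability.QuantumComplexity.ADHMachine
import Literature.Computability.QuantumComplexity.PostBQPPathSums
import HarnessLib

/-!
# The post-selected path-pair machine as an `FP` string function (`PostBQP ⊆ PP`, machine half)

Machine half of the proof of `PostBQP ⊆ PP` (Aaronson 2005, Prop. 2), continuing
`PostBQPPathSums.lean` (the weights `wtA evWt ∈ {0, ±1}` of a guessed quadruple `(b, b', t, t')`
and the sign theorem `extX_pos`/`extX_neg` for their sum) and reusing the Adleman–DeMarrais–Huang
machine of `ADHMachine.lean` (walk records `rec6`, the clocked walk `passF`, both walks `twoF F`,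
the verdict bricks `okT`, `sgT`, `isD`, `V4`, `Vm4`, `c0T`). The predicate of the `P·P`
presentation (`PP = pMajority P`, Gill) reads `⟨x, b b' t t' e u⟩` and

1. walks the two guessed paths `b`, `b'` through the `|x|`-th circuit (`ADH.twoF`);
2. **prolongs each path by the phase coins** `t`, `t'` (`k = |descFn x|` coins each): one
   *popcount round* `pcR` reads a coin and adds it to the unary phase register modulo `8`
   (`pcR_rec`), and `pcPassF = pcR^{|d|}` (`iterate_mem_FP_of_growth`, clocked by the kept
   description) computes `φ ↦ (φ + pc t) mod 8` (`iterate_pcR`); the plumbing `stage3F`,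
   `stage4F` feeds the coins left by the walks to the first pass and those left by the first pass
   to the second (`fourF_boolPair`);
3. answers with `verdict2F`: on a *nontrivial* guess (both walks valid, same final label, and the
   post-selection wire `1` of that label set) of phase class `0` resp. `4` it answers by the sign
   of the output wire `0` resp. its negation — weight `wtA = evWt · reA ∈ {±1}` — and on every
   other guess (weight `0`) it answers with the next coin `e` (`verdict2F_apply`, `vtree2_eq`), so
   that "yes" minus "no" over `e ∈ {0,1}` is `2 · wtA` (`PostBQPSubsetPP.lean`).

Main statements: `postFn F ∈ FP` (`postFn_mem_FP`), `OneBit (postFn F)`, and the value theorem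
**`postFn_boolPair`**: on `⟨x, y⟩` with `|y| ≥ 2μ + 2k + 1` the answer is
`wtAnswer (wtA evWt gates w₀ (y↾μ) (y⇂μ↾μ) (y⇂2μ↾k) (y⇂(2μ+k)↾k)) (head (y⇂(2μ+2k)))`.

## References

* S. Aaronson, *Quantum computing, postselection, and probabilistic polynomial-time*, Proc. R.
  Soc. A 461 (2005) 3473–3482, arXiv:quant-ph/0412187, §3 Prop. 2 (proof: the two sides of the
  `PP` ledger).
* L. M. Adleman, J. DeMarrais, M.-D. A. Huang, *Quantum computability*, SIAM J. Comput. 26 (1997),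
  §6 Lemma 6.10 (proof: the machine `M'`, steps 1–5).
* S. Arora, B. Barak, *Computational Complexity: A Modern Approach*, CUP 2009, §1.3 (closure of
  polynomial time under composition and clocked loops).
-/

noncomputable section

namespace Literature.Computability.QuantumComplexity

namespace PostPP

open _root_.Computability Polynomial Complexity Complexity.Brick Complexity.Plumb Cryptography ADH

-- As in `ADHMachine.lean`: keep `nthF 0` / `sndPow 0` folded so that the record-field lemmas of that
-- file (`fields_rec6`, `pieces_rec6`, …) apply verbatim; the two `simp` attributes are only erased
-- inside this file.
attribute [-simp] Brick.nthF_zero Brick.sndPow_zero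

variable {N : ℕ}

/-! ### Phases stay reduced modulo `8` -/

/-- Every total step reduces the phase register modulo `8`. [folklore] -/
theorem tStep_phase_lt (g : QGate cliffordT N) (c : Bool) (s : TState N) : (tStep g c s).2.1 < 8 := by
  obtain ⟨w, φ, v⟩ := s
  cases g with
  | oracle k e => exact Nat.mod_lt _ (by norm_num)
  | gate op e => cases op <;> exact Nat.mod_lt _ (by norm_num)

/-- Hence the phase of a total walk started below `8` stays below `8`. [folklore] -/
theorem tRun_phase_lt (gs : List (QGate cliffordT N)) :
    ∀ (cs : List Bool) (s : TState N), s.2.1 < 8 → (tRun gs cs s).2.1 < 8 := by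
  induction gs with
  | nil => intro cs s h; exact h
  | cons g gs ih => intro cs s _; exact ih _ _ (tStep_phase_lt g _ s)

/-! ### The popcount round and the popcount pass -/

/-- **One popcount round** on a walk record `⟨d, E, co, w, ph, v⟩`: read the first unread coin,
add it to the phase modulo `8` (`1^φ ↦ 1^{(φ + c) mod 8}`), drop it; all other fields kept. This
prolongs the guessed path by one factor `ω^c`. [cite: Aaronson2005, §3 Prop. 2 (proof: contributions "each … computable in classical polynomial time")] -/
def pcR : List Bool → List Bool := mk6 dF eF co'F wF (iteFn cT (addPh 1) (addPh 0)) vF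

/-- `pcR ∈ FP` (composition of bricks). [cite: AroraBarak2009, §1.3] -/
theorem pcR_mem_FP : pcR ∈ FP :=
  mk6_mem_FP (nthF_mem_FP 0) (nthF_mem_FP 1) co'F_mem_FP (nthF_mem_FP 3)
    (iteFn_mem_FP cT_mem_FP (addPh_mem_FP 1) (addPh_mem_FP 0)) (sndPow_mem_FP 4)

/-- The choice-bit test, on every string. [folklore] -/
theorem cT_apply (z : List Bool) : cT z = [headBit (coF z)] := by simp [cT]

/-- Value of the popcount round, on every string. [folklore] -/
theorem pcR_apply (z : List Bool) :
    pcR z = rec6 (dF z) (eF z) (coF z).tail (wF z)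
      (ones (((phF z).length + (headBit (coF z)).toNat) % 8)) (vF z) := by
  rw [pcR, mk6_apply, iteFn_apply (cT_apply z), addPh_apply, addPh_apply]
  cases headBit (coF z) <;> rfl

/-- Constant growth of the popcount round, on every string. [folklore] -/
theorem length_pcR_le (z : List Bool) : (pcR z).length ≤ z.length + roundGrowth := by
  have hf := length_fields_le z
  have h2 : ((coF z).tail).length ≤ (coF z).length := by simp
  have h4 : (ones (((phF z).length + (headBit (coF z)).toNat) % 8)).length ≤ 7 := by
    rw [length_ones]
    have := Nat.mod_lt ((phF z).length + (headBit (coF z)).toNat) (show 0 < 8 by norm_num)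
    omega
  rw [pcR_apply, length_rec6]
  simp only [roundGrowth]
  omega

/-- The popcount round keeps the first field (the clock). [folklore] -/
theorem fstF_pcR (z : List Bool) : fstF (pcR z) = fstF z := by
  rw [pcR_apply]
  simp [Brick.nthF_zero]

/-- **The popcount pass**: `|d|` popcount rounds. [cite: AroraBarak2009, §1.4.1 (clocked loops)] -/
def pcPassF : List Bool → List Bool := fun r => pcR^[(X : Polynomial ℕ).eval (fstF r).length] r

/-- **`pcPassF ∈ FP`** (`iterate_mem_FP_of_growth`). [cite: AroraBarak2009, §1.3, §1.4.1] -/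
theorem pcPassF_mem_FP : pcPassF ∈ FP :=
  iterate_mem_FP_of_growth pcR_mem_FP roundGrowth fstF_pcR
    (fun w => (length_pcR_le w).trans (by nlinarith [Nat.zero_le (boolUnpair w).1.length])) X

/-- One popcount round on a record. [folklore] -/
theorem pcR_rec (d E co wl v : List Bool) (φ : ℕ) :
    pcR (rec6 d E co wl (ones φ) v) = rec6 d E co.tail wl (ones ((φ + (headBit co).toNat) % 8)) v := by
  obtain ⟨h0, h1, h2, h3, h4, h5⟩ := fields_rec6 d (ones φ) v E co wl
  rw [pcR_apply, h0, h1, h2, h3, h4, h5, length_ones]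

/-- **`k` popcount rounds** consume `k` coins and add their popcount to the phase modulo `8`.
[folklore] -/
theorem iterate_pcR (d E wl v : List Bool) : ∀ (k : ℕ) (co : List Bool) (φ : ℕ), φ < 8 →
    pcR^[k] (rec6 d E co wl (ones φ) v) = rec6 d E (co.drop k) wl (ones ((φ + pc (co.take k)) % 8)) v := by
  intro k
  induction k with
  | zero => intro co φ hφ; simp [Nat.mod_eq_of_lt hφ]
  | succ k ih =>
    intro co φ _
    rw [Function.iterate_succ_apply, pcR_rec, ih _ _ (Nat.mod_lt _ (by norm_num))]
    cases co with
    | nil => simp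
    | cons c cs =>
      simp only [List.tail_cons, headBit_cons, List.drop_succ_cons, List.take_succ_cons, pc_cons]
      have e : ((φ + c.toNat) % 8 + pc (cs.take k)) % 8 = (φ + (pc (cs.take k) + c.toNat)) % 8 := by omega
      rw [e]

/-- The popcount pass on a record runs `|d|` rounds. [folklore] -/
theorem pcPassF_rec6 (d E co wl ph v : List Bool) :
    pcPassF (rec6 d E co wl ph v) = pcR^[d.length] (rec6 d E co wl ph v) := by
  simp [pcPassF, fstF]

/-! ### Plumbing: the two popcount passes after the two walks -/

/-- Record of the first pass, from the pair `⟨R₁, R₂⟩` of walk records: the coins left by both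
walks (from `R₂`), label, phase and flag of the first walk. [folklore] -/
def rec3F : List Bool → List Bool :=
  mk6 (dF ∘ fstF) (fun _ => []) (coF ∘ sndF) (wF ∘ fstF) (phF ∘ fstF) (vF ∘ fstF)
/-- Stage 3: `⟨R₁, R₂⟩ ↦ ⟨Q₁, R₂⟩`, `Q₁` the first walk's record after its popcount pass. [folklore] -/
def stage3F : List Bool → List Bool := pr (pcPassF ∘ rec3F) sndF
/-- Record of the second pass, from `⟨Q₁, R₂⟩`: the coins left by the first pass (from `Q₁`),
label, phase and flag of the second walk. [folklore] -/
def rec4F : List Bool → List Bool :=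
  mk6 (dF ∘ sndF) (fun _ => []) (coF ∘ fstF) (wF ∘ sndF) (phF ∘ sndF) (vF ∘ sndF)
/-- Stage 4: `⟨Q₁, R₂⟩ ↦ ⟨Q₁, Q₂⟩`. [folklore] -/
def stage4F : List Bool → List Bool := pr fstF (pcPassF ∘ rec4F)

/-- `rec3F ∈ FP` (composition of bricks). [folklore] -/
theorem rec3F_mem_FP : rec3F ∈ FP :=
  mk6_mem_FP (comp_mem_FP (nthF_mem_FP 0) fstF_mem_FP) (const_mem_FP _) (comp_mem_FP (nthF_mem_FP 2) sndF_mem_FP)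
    (comp_mem_FP (nthF_mem_FP 3) fstF_mem_FP) (comp_mem_FP (nthF_mem_FP 4) fstF_mem_FP)
    (comp_mem_FP (sndPow_mem_FP 4) fstF_mem_FP)
/-- `stage3F ∈ FP` (composition of bricks). [folklore] -/
theorem stage3F_mem_FP : stage3F ∈ FP :=
  fanoutFn_mem_FP (comp_mem_FP pcPassF_mem_FP rec3F_mem_FP) sndF_mem_FP
/-- `rec4F ∈ FP` (composition of bricks). [folklore] -/
theorem rec4F_mem_FP : rec4F ∈ FP :=
  mk6_mem_FP (comp_mem_FP (nthF_mem_FP 0) sndF_mem_FP) (const_mem_FP _) (comp_mem_FP (nthF_mem_FP 2) fstF_mem_FP)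
    (comp_mem_FP (nthF_mem_FP 3) sndF_mem_FP) (comp_mem_FP (nthF_mem_FP 4) sndF_mem_FP)
    (comp_mem_FP (sndPow_mem_FP 4) sndF_mem_FP)
/-- `stage4F ∈ FP` (composition of bricks). [folklore] -/
theorem stage4F_mem_FP : stage4F ∈ FP :=
  fanoutFn_mem_FP fstF_mem_FP (comp_mem_FP pcPassF_mem_FP rec4F_mem_FP)

/-- `rec3F` on a pair of records. [folklore] -/
theorem rec3F_pair (d₁ E₁ co₁ wl₁ ph₁ v₁ d₂ E₂ co₂ wl₂ ph₂ v₂ : List Bool) :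
    rec3F (boolPair (rec6 d₁ E₁ co₁ wl₁ ph₁ v₁) (rec6 d₂ E₂ co₂ wl₂ ph₂ v₂)) = rec6 d₁ [] co₂ wl₁ ph₁ v₁ := by
  simp [rec3F, Brick.nthF_zero, nthF, sndPow]

/-- `rec4F` on a pair of records. [folklore] -/
theorem rec4F_pair (d₁ E₁ co₁ wl₁ ph₁ v₁ d₂ E₂ co₂ wl₂ ph₂ v₂ : List Bool) :
    rec4F (boolPair (rec6 d₁ E₁ co₁ wl₁ ph₁ v₁) (rec6 d₂ E₂ co₂ wl₂ ph₂ v₂)) = rec6 d₂ [] co₁ wl₂ ph₂ v₂ := by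
  simp [rec4F, Brick.nthF_zero, nthF, sndPow]

section Four

variable (F : QCircuitFamily cliffordT)

/-- **Both walks, then both popcount passes**: `⟨x, y⟩ ↦ ⟨Q₁, Q₂⟩`.
[cite: Aaronson2005, §3 Prop. 2 (proof)] -/
def fourF : List Bool → List Bool := stage4F ∘ stage3F ∘ twoF F

/-- `fourF F ∈ FP` for a uniform family. [cite: AroraBarak2009, §1.3] -/
theorem fourF_mem_FP (hU : F.IsUniform) : fourF F ∈ FP :=
  comp_mem_FP stage4F_mem_FP (comp_mem_FP stage3F_mem_FP (twoF_mem_FP F hU))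

/-- **Value of `fourF`** on `⟨x, y⟩`: the two walk records with their coins replaced by what the
passes leave and their phases advanced by the popcounts of the two phase-coin blocks (`k = |d|`
coins each, `d` the description of the `|x|`-th circuit). [cite: Aaronson2005, §3 Prop. 2 (proof)] -/
theorem fourF_boolPair (hF : F.IsOracleFree) (x y : List Bool) :
    fourF F (boolPair x y) =
      (let gs := (F.circ x.length).gates
       let μ := gs.length
       let d := F.descFn x
       let k := d.length
       let r := tRun gs y (w₀ F x, 0, true)
       let r' := tRun gs (y.drop μ) (w₀ F x, 0, true)
       let y₂ := (y.drop μ).drop μ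
       boolPair (rec6 d [] (y₂.drop k) (List.ofFn r.1) (ones ((r.2.1 + pc (y₂.take k)) % 8)) [r.2.2])
         (rec6 d [] ((y₂.drop k).drop k) (List.ofFn r'.1) (ones ((r'.2.1 + pc ((y₂.drop k).take k)) % 8))
           [r'.2.2])) := by
  have htwo := twoF_boolPair F x y hF
  simp only at htwo ⊢
  have hφ₁ := tRun_phase_lt (F.circ x.length).gates y (w₀ F x, 0, true) (by norm_num)
  have hφ₂ := tRun_phase_lt (F.circ x.length).gates (y.drop (F.circ x.length).gates.length) (w₀ F x, 0, true)
    (by norm_num)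
  show stage4F (stage3F (twoF F (boolPair x y))) = _
  rw [htwo]
  show fanoutFn fstF (pcPassF ∘ rec4F) (fanoutFn (pcPassF ∘ rec3F) sndF _) = _
  rw [fanoutFn_apply, fanoutFn_apply]
  simp only [Function.comp_apply, sndF_boolPair, fstF_boolPair, rec3F_pair, pcPassF_rec6]
  rw [iterate_pcR _ _ _ _ _ _ _ hφ₁, rec4F_pair, pcPassF_rec6, iterate_pcR _ _ _ _ _ _ _ hφ₂]

end Four

/-! ### The verdict -/

section Verdict

/-- The post-selection bit: wire `1` of the first walk's final label.
[cite: Aaronson2005, §3 Def. 1 (i) and Prop. 2 (proof: "sum only over paths where the first qubit is |1⟩ at the end")] -/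
def psT : List Bool → List Bool := bitT (List.tail ∘ w1F)

/-- `psT ∈ FP` (composition of bricks). [folklore] -/
theorem psT_mem_FP : psT ∈ FP :=
  bitT_mem_FP (comp_mem_FP PRelSigma.tail_mem_FP (comp_mem_FP (nthF_mem_FP 3) fstF_mem_FP))

/-- The Boolean model of `psT`, on every string. [folklore] -/
theorem psT_apply (t : List Bool) : psT t = [headBit (w1F t).tail] := bitT_apply _ _

/-- **The verdict**: on a nontrivial post-selected guess of class `0` answer by the output sign,
of class `4` by its negation, and on every other guess by the next coin.
[cite: Aaronson2005, §3 Prop. 2 (proof: "we simply put the positive contributions … to S₁ and negative contributions to S₀ on one side of the ledger, and the negative contributions to S₁ and positive contributions to S₀ on the other side")] -/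
def verdict2F : List Bool → List Bool :=
  iteFn okT (iteFn psT (iteFn (isD 0) V4 (iteFn (isD 4) Vm4 c0T)) c0T) c0T

/-- **`verdict2F ∈ FP`.** [cite: AroraBarak2009, §1.3] -/
theorem verdict2F_mem_FP : verdict2F ∈ FP :=
  iteFn_mem_FP okT_mem_FP (iteFn_mem_FP psT_mem_FP (iteFn_mem_FP (isD_mem_FP 0) V4_mem_FP
    (iteFn_mem_FP (isD_mem_FP 4) Vm4_mem_FP c0T_mem_FP)) c0T_mem_FP) c0T_mem_FP

/-- The verdict tree on Boolean data: validity `ok`, post-selection bit `ps`, output sign `sg`,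
class tests `e0`, `e4`, extra coin `e`. [folklore] -/
def vtree2 (ok ps sg e0 e4 e : Bool) : Bool :=
  if ok then
    (if ps then
      (if e0 then (if sg then true else false) else if e4 then (if sg then false else true) else e)
     else e)
  else e

/-- `verdict2F` is the verdict tree on the Boolean models of its tests, on every string. [folklore] -/
theorem verdict2F_apply (t : List Bool) :
    verdict2F t = [vtree2 (okB t) (headBit (w1F t).tail) (headBit (w1F t)) (decide (diffF t = ones 0))
      (decide (diffF t = ones 4)) (headBit (co2F t))] := by
  simp only [verdict2F, V4, Vm4, iteFn_apply (okT_apply t), iteFn_apply (psT_apply t),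
    iteFn_apply (isD_apply _ t), iteFn_apply (sgT_apply t), c0T_apply]
  unfold vtree2
  split_ifs <;> rfl

/-- `verdict2F` is one-bit. [folklore] -/
theorem oneBit_verdict2F : OneBit verdict2F := fun t => ⟨_, verdict2F_apply t⟩

/-- **Answering by weight**: weight `1` answers "yes", weight `-1` answers "no", weight `0` answers
with the extra coin — so that over the two values of the coin, "yes" minus "no" is `2w`.
[cite: Aaronson2005, §3 Prop. 2 (proof: the two sides of the ledger)] -/
def wtAnswer (w : ℤ) (e : Bool) : Bool := if w = 1 then true else if w = -1 then false else e

/-- **The verdict tree answers by the weight** `[ok] · [ps] · sign · reA D`.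
[cite: Aaronson2005, §3 Prop. 2 (proof)] -/
theorem vtree2_eq (ok ps sg : Bool) (D : ℕ) (hD : D < 8) (e : Bool) :
    vtree2 ok ps sg (decide (D = 0)) (decide (D = 4)) e =
      wtAnswer (if ok then (if ps then (if sg then 1 else -1) else 0) * reA D else 0) e := by
  interval_cases D <;> revert ok ps sg e <;> decide

end Verdict

/-! ### The predicate `postFn` -/

section PostFn

variable (F : QCircuitFamily cliffordT)

/-- **The post-selected ADH predicate** on `⟨x, y⟩`: both walks, both popcount passes, then the
verdict. [cite: Aaronson2005, §3 Prop. 2 (proof)] -/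
def postFn : List Bool → List Bool := verdict2F ∘ fourF F

/-- **`postFn F ∈ FP`** for a uniform family. [cite: Aaronson2005, §3 Prop. 2 (proof: "computable in classical polynomial time")] -/
theorem postFn_mem_FP (hU : F.IsUniform) : postFn F ∈ FP := comp_mem_FP verdict2F_mem_FP (fourF_mem_FP F hU)

/-- `postFn F` is one-bit. [folklore] -/
theorem oneBit_postFn : OneBit (postFn F) := oneBit_verdict2F.comp _

/-- The first two bits of a label with at least two wires. [folklore] -/
theorem headBit_ofFn_two {M : ℕ} (z : QReg (M + 2)) :
    headBit (List.ofFn z).tail = z ⟨1, by omega⟩ ∧ headBit (List.ofFn z) = z ⟨0, by omega⟩ := by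
  rw [List.ofFn_succ, List.ofFn_succ]
  exact ⟨headBit_cons _ _, headBit_cons _ _⟩

/-- The event weight read off the first two bits of the label. [folklore] -/
theorem evWt_eq_headBit {M : ℕ} (z : QReg M) :
    evWt z = if headBit (List.ofFn z).tail then (if headBit (List.ofFn z) then 1 else -1) else 0 := by
  unfold evWt
  rcases M with _ | _ | M
  · simp
  · simp [List.ofFn_succ]
  · obtain ⟨h1, h0⟩ := headBit_ofFn_two z
    rw [h1, h0, dif_pos (by omega : 1 < M + 2)]

/-- **The weight read off the two total walks** (what the machine computes): both flags set and
equal endpoints give `c(z) · reA` of the prolonged class of the two phase registers, anything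
else gives `0`. [cite: Aaronson2005, §3 Prop. 2 (proof)] -/
theorem wtA_eq_of_tRun (c : QReg N → ℤ) (gs : List (QGate cliffordT N)) (w : QReg N)
    (cs cs' t t' : List Bool) (h : gs.length ≤ cs.length) (h' : gs.length ≤ cs'.length) :
    wtA c gs w (cs.take gs.length) (cs'.take gs.length) t t' =
      (let r := tRun gs cs (w, 0, true)
       let r' := tRun gs cs' (w, 0, true)
       if r.2.2 = true ∧ r'.2.2 = true ∧ r.1 = r'.1 then
         c r.1 * reA ((r.2.1 + pc t + 7 * (r'.2.1 + pc t')) % 8) else 0) := by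
  have h1 := tRun_spec gs cs w 0 (by norm_num) h
  have h2 := tRun_spec gs cs' w 0 (by norm_num) h'
  unfold wtA extDiff
  rcases hp : pathRun gs w (cs.take gs.length) with _ | ⟨z₁, φ⟩ <;>
    rcases hp' : pathRun gs w (cs'.take gs.length) with _ | ⟨z₂, φ'⟩ <;>
    simp only [hp, hp'] at h1 h2 ⊢
  · simp [h1]
  · simp [h1]
  · simp [h2]
  · simp only [h1, h2, zero_add, true_and]
    by_cases hz : z₁ = z₂
    · subst hz
      rw [if_pos rfl, if_pos rfl]
      simp only
      congr 2
      omega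
    · rw [if_neg hz, if_neg hz]

/-- The weight model of the verdict: flags, labels and the class. [folklore] -/
def wtM (v₁ v₂ : Bool) (z₁ z₂ : QReg N) (D : ℕ) : ℤ :=
  if v₁ = true ∧ v₂ = true ∧ z₁ = z₂ then evWt z₁ * reA D else 0

/-- The verdict on a pair of final records answers by the weight model.
[cite: Aaronson2005, §3 Prop. 2 (proof)] -/
theorem verdict2F_pair (d₁ co₁ d₂ co₂ : List Bool) (z₁ z₂ : QReg N) (φ₁ φ₂ : ℕ) (v₁ v₂ : Bool) :
    verdict2F (boolPair (rec6 d₁ [] co₁ (List.ofFn z₁) (ones φ₁) [v₁]) (rec6 d₂ [] co₂ (List.ofFn z₂) (ones φ₂) [v₂])) =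
      [wtAnswer (wtM v₁ v₂ z₁ z₂ ((φ₁ + 7 * φ₂) % 8)) (headBit co₂)] := by
  rw [verdict2F_apply, diffF_pair]
  simp only [okB, Function.comp_apply, fstF_boolPair, sndF_boolPair, rec6, nthF, sndPow, List.ofFn_inj,
    ones_inj, List.cons.injEq, and_true, Bool.decide_eq_true]
  rw [vtree2_eq _ _ _ _ (Nat.mod_lt _ (by norm_num)), wtM, evWt_eq_headBit]
  cases v₁ <;> cases v₂ <;> by_cases h : z₁ = z₂ <;> simp [h]

/-- **Value of the post-selected predicate.** On `⟨x, b b' t t' e u⟩` (`|b| = |b'| = μ` the number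
of gates of the `|x|`-th circuit, `|t| = |t'| = k = |descFn x|`, one more coin `e`, `u`
arbitrary) the predicate answers `wtAnswer (wtA evWt gates w₀ b b' t t') e`.
[cite: Aaronson2005, §3 Prop. 2 (proof)] -/
theorem postFn_boolPair (hF : F.IsOracleFree) (x : List Bool) (b b' t t' u : List Bool) (e : Bool)
    (hb : b.length = (F.circ x.length).gates.length) (hb' : b'.length = (F.circ x.length).gates.length)
    (ht : t.length = (F.descFn x).length) (ht' : t'.length = (F.descFn x).length) :
    postFn F (boolPair x (b ++ (b' ++ (t ++ (t' ++ (e :: u)))))) =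
      [wtAnswer (wtA evWt (F.circ x.length).gates (w₀ F x) b b' t t') e] := by
  have hfour := fourF_boolPair F hF x (b ++ (b' ++ (t ++ (t' ++ (e :: u)))))
  have hwt := wtA_eq_of_tRun evWt (F.circ x.length).gates (w₀ F x) (b ++ (b' ++ (t ++ (t' ++ (e :: u)))))
    ((b ++ (b' ++ (t ++ (t' ++ (e :: u))))).drop (F.circ x.length).gates.length) t t'
    (by simp; omega) (by simp; omega)
  simp only at hfour hwt ⊢
  set gs := (F.circ x.length).gates with hgs
  set μ := gs.length with hμ
  set k := (F.descFn x).length with hk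
  set y := b ++ (b' ++ (t ++ (t' ++ (e :: u)))) with hy
  have e1 : y.take μ = b := by rw [hy]; exact List.take_left' hb
  have e2 : y.drop μ = b' ++ (t ++ (t' ++ (e :: u))) := by rw [hy]; exact List.drop_left' hb
  have e3 : (y.drop μ).take μ = b' := by rw [e2]; exact List.take_left' hb'
  have e4 : (y.drop μ).drop μ = t ++ (t' ++ (e :: u)) := by rw [e2]; exact List.drop_left' hb'
  have e5 : (t ++ (t' ++ (e :: u))).take k = t := List.take_left' ht
  have e6 : (t ++ (t' ++ (e :: u))).drop k = t' ++ (e :: u) := List.drop_left' ht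
  have e7 : (t' ++ (e :: u)).take k = t' := List.take_left' ht'
  have e8 : (t' ++ (e :: u)).drop k = e :: u := List.drop_left' ht'
  rw [e1, e3] at hwt
  rw [hwt]
  obtain ⟨⟨z₁, φ₁, v₁⟩, hr⟩ : ∃ s, tRun gs y (w₀ F x, 0, true) = s := ⟨_, rfl⟩
  obtain ⟨⟨z₂, φ₂, v₂⟩, hr'⟩ : ∃ s, tRun gs (y.drop μ) (w₀ F x, 0, true) = s := ⟨_, rfl⟩
  rw [hr, hr'] at hfour
  simp only [hr, hr']
  show verdict2F (fourF F (boolPair x y)) = _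
  rw [hfour, e4, e5, e6, e7, e8, verdict2F_pair, headBit_cons, wtM]
  have hD : ((φ₁ + pc t) % 8 + 7 * ((φ₂ + pc t') % 8)) % 8 = (φ₁ + pc t + 7 * (φ₂ + pc t')) % 8 := by
    omega
  rw [hD]

end PostFn

end PostPP

end Literature.Computability.QuantumComplexity
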